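import Summits.MatrixMultiplication.OmegaCensus.STPPKernelListerOrderLaw32
import Summits.MatrixMultiplication.OmegaCensus.STPPKernelListerOrderN34N37
import Summits.MatrixMultiplication.OmegaCensus.STPPKernelListerOrderN38
import Summits.MatrixMultiplication.OmegaCensus.STPPKernelListerOrderN39
import Summits.MatrixMultiplication.OmegaCensus.STPPKernelListerOrderN40
import Summits.MatrixMultiplication.OmegaCensus.STPPKernelListerOrderN41
import Summits.MatrixMultiplication.OmegaCensus.STPPKernelListerOrderN43

/-!
# ω-census (abelian STPP census): **NO abelian group of order ≤ 43, other than of order 33, 35, 36, 42, admits a beating STPP family — KERNEL** (order law, second range)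

HONEST FRAMING (pub-omega census; verbatim): lottery ticket; floor = certified bounds/negative ranges.
Census STRUCTURE (seat pub-omega-stpp-2 gen 30, 2026-08-29), family (b2).  Nothing here is progress on `ω` — the theorem EXCLUDES: for every finite
abelian group `H` with `|H| ≤ 43` and `|H| ∉ {33, 35, 36, 42}` (64 of the 71 isomorphism types of abelian groups of order `≤ 43`), every `m` and
every STPP family `(Aᵢ, Bᵢ, Cᵢ)_{i<m}` of `H` (CKSU Def. 5.1) has `Σᵢ |Aᵢ||Bᵢ||Cᵢ| ≤ |H|`, so CKSU Thm. 5.5 yields no `ω < 3` from `H`.  Assembly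
of `KLister.volume_le_card_of_card_le_32` with the dead-list-free order capstones `KLister.volume_le_of_card_eq_34/37/38/39/40/41/43`.  The four
excluded orders are exactly those `≤ 43` at which the tree laws leave survivors (`KLister.deadN33 = deadN35 = [233_233, 233_323]`, `deadN36 =
[111_233_233]`, `deadN42 = [233_333, 111_233_234, 223_242_422]`; conditional capstones `KLister.volume_le_of_card_eq_<n>_of_dead`).
-/

open Finset

namespace Summit.MatrixMultiplication.OmegaCensus.KLister

open Literature.Computability.AlgebraicComplexity

/-- **ORDER LAW (kernel): no finite abelian group of order `≤ 43`, except possibly of order `33, 35, 36, 42`, admits a beating STPP family** —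
`|H| ≤ 43`, `|H| ∉ {33, 35, 36, 42}`, `(A, B, C)` an STPP family of `H` (CKSU Def. 5.1) `⟹ Σᵢ |Aᵢ||Bᵢ||Cᵢ| ≤ |H|`.
[cite: CohnKleinbergSzegedyUmans2005, Def. 5.1, Thm. 5.5] -/
theorem volume_le_card_of_card_le_43 {H : Type*} [AddCommGroup H] [Fintype H] [DecidableEq H] (h43 : Fintype.card H ≤ 43)
    (h33 : Fintype.card H ≠ 33) (h35 : Fintype.card H ≠ 35) (h36 : Fintype.card H ≠ 36) (h42 : Fintype.card H ≠ 42)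
    {m : ℕ} (A B C : Fin m → Finset H) (hS : IsSTPP A B C) : ∑ i, #(A i) * #(B i) * #(C i) ≤ Fintype.card H := by
  by_cases h32 : Fintype.card H ≤ 32
  · exact volume_le_card_of_card_le_32 h32 A B C hS
  obtain ⟨n, hn⟩ : ∃ n, Fintype.card H = n := ⟨_, rfl⟩
  rw [hn] at h32 h43 h33 h35 h36 h42 ⊢
  interval_cases n
  exacts [(absurd rfl h33), (volume_le_of_card_eq_34 hn A B C hS), (absurd rfl h35), (absurd rfl h36), (volume_le_of_card_eq_37 hn A B C hS), (volume_le_of_card_eq_38 hn A B C hS), (volume_le_of_card_eq_39 hn A B C hS), (volume_le_of_card_eq_40 hn A B C hS), (volume_le_of_card_eq_41 hn A B C hS), (absurd rfl h42), (volume_le_of_card_eq_43 hn A B C hS)]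

end Summit.MatrixMultiplication.OmegaCensus.KLister
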